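import Summits.QuantumFields.YangMills.Theorems.UnitScaleTiltProp7ComplementaryProjectorBlockDecay
import HarnessLib

/-!
# Route `UnitScaleTilt`, crux K1 «MinimiserStabilityRegPr» (stmt-QuantumFields-19200), EX face after S45 — **(L3′b)-VALUE FILE V5: THE POINTWISE VALUE KERNEL OF PRINT'S
# COMPLEMENTARY GAUGE PROJECTOR `P = 1 − R_{Q″}(U₀)` BETWEEN TWO FINE SITES DECAYS IN THE COARSE DISTANCE OF THEIR BLOCKS, WITH THE FACTOR `c₀∕c₁` (= print's `η³` at the pin
# `c₁ = c₀ℓ³`)** — routeR-w2's β-row ✓`Prop7ComplementaryProjectorBlockDecay.norm_inner_sub_projR_blocks_le` REREAD WITH POINTWISE COLUMN LETTERS: B1 ✓`norm_inner_sub_projR_le` in px17's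
# coarse spike basis, the POINTWISE column row (the chair's V4 `…MassiveColumnPointwiseDecay` shape, DISPLAYED here as the letter `hcol`), B2c ✓`norm_gram_inv_spike_le_exp_neg_tdist`,
# ✓`triple_sum_exp_le` (★p1 g25 CARD-19200-V3-g25 §4 «V5 = … VALUE kernel of `P = 1 − R_{Q″}` with `η³e^{−δd}`»; width seat `ym3-torus-px5` gen 12)

Cell `ym3-torus` (HUMAN RULING D-0037; rung R3 = SU(2) YM₃ on T³ — NOT d = 4, NOT infinite volume, NOT a mass gap, NOT Clay).
THEOREMS ONLY (0 `def`, 0 `sorry`); `--supports stmt-QuantumFields-19200 --as helper`; count-neutral.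

WHY.  The β-row bounds the kernel of `P` between two BLOCK-SUPPORTED fields in `L²(c₀)`; read on two fine spikes `δ_x ⊗ X`, `δ_{x′} ⊗ X′` it gives `const·c₀·‖X‖·‖X′‖·e^{−μ′d}` — the `L²`
currency loses the block volume against print's POINTWISE (3.49) value, which carries `η³`.  The (L3′b)-VALUE storey (V1 ✓p761229 Kato bootstrap → V2∕V2b → V3∕V4 decay) delivers the
K-FREE POINTWISE size of the LOD columns `ψ_{y,Y} = G_a(Q″†(δ_y ⊗ Y))`: `‖ψ_{y,Y}(x)‖_{W₂} ≤ C_pt·e^{−κ·tdist(B(x), y)}·‖Y‖`.  In the coarse spike basis `b_c i = ι(δ_{σ i.1} ⊗ (√c₁)⁻¹E_{jk})`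
(✓`spike_eq_lift`) this reads `‖⟪G(T(b_c i)), toL2S(δ_x ⊗ X)⟫‖ ≤ c₀(√c₁)⁻¹·C_pt·‖X‖_F·e^{−κ·tdist(B(x), σ i.1)}` (§1), and B1's double Gram sum with B2c's `‖M⁻¹ i i′‖ ≤ C_N e^{−μ′·tdist}` and the
coarse volume sums exactly as in the β-row (§2).  The pairing's own `c₀` is the `L²(c₀)` normalisation of `δ_x ⊗ X`; the remaining `c₀∕c₁` is print's `η³` (§3: the pointwise corollary).
WHAT IS PROVED (ns `Summit.QuantumFields.YangMills.Theorems.Prop7ComplementaryProjectorPointwiseDecay`; letters `hseq hι hT G hAG hGA` of ✓`Prop7ComplementaryProjectorBlockDecay` VERBATIM,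
B2c's window∕gap rows at the Gram slope `μ′`, and the POINTWISE COLUMN LETTER `hcol` at rate `κ > μ′`).
* §1 `norm_spikeEntry_le` (`‖(√c₁)⁻¹E_{jk}‖ ≤ (√c₁)⁻¹`), ★ `norm_inner_spike_column_single_le` (the spike-vs-spike column row from `hcol`).
* §2 ★★★ `norm_inner_single_sub_projR_single_le` — `‖⟪toL2S(δ_x ⊗ X), (1 − projR Δ_{U₀} Q″)(toL2S(δ_{x′} ⊗ X′))⟫‖ ≤ (c₀(√c₁)⁻¹C_pt‖X‖_F)·(c₀(√c₁)⁻¹C_pt‖X′‖_F)·C_N(μ′)·(4(2(1 + 1∕(κ−μ′)))³)²·e^{−μ′·tdist(B x, B x′)}`.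
* §3 ★★ `norm_equiv_sub_projR_single_le` — THE POINTWISE VALUE KERNEL: `‖((1 − projR)(toL2S(δ_{x′} ⊗ X′)))(x)‖_{W₂} ≤ (c₀∕c₁)·C_pt²·C_N(μ′)·(4(2(1 + 1∕(κ−μ′)))³)²·e^{−μ′·tdist(B x, B x′)}·‖X′‖_F`.
HYP-SAT (★★OWNER RULING №42): `RegPr` + the LOD letters (`hseq hι hT` ⟸ ✓`exists_intertwiner_of_regPr` ∕ ✓`inner_adjoint_comp`; `G hAG hGA` ⟸ ✓`Prop7MassivePropagatorCoercive.exists_massive_inverse`),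
the window∕gap rows at `μ′` and `hcoer` (discharged from `RegPr` for small `μ′` by ✓`Prop7ComplementaryProjectorBlockDecayKnit.norm_inner_sub_projR_blocks_le_of_regPr`'s letters, K-free), and `hcol`
(the chair's V4 assembly over ✓p761896∕✓p761979, `κ = min μ ¼`-class) — all on the literal T³ families; nothing eventual.
HONEST SCOPE.  Composition of landed rows; CONDITIONAL on the displayed letters; the VALUE kernel of `P` only — no `D P D*` ((3.49) proper needs the GRADIENT key (G1-·)∕(★)), nothing of the
ten EX rows, `hT`, `hGF`, EX `stub_existenceMinimalOrbit` or the crux is proved here; the Yang–Mills mass gap is NOT proved.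

References: T. Bałaban, CMP **99** (1985) 389–434 [Balaban1985BackgroundPropagators] ((3.11) p.392, (3.16) p.393, (3.21)–(3.25) p.394, Thm 3.1 (3.42) p.397, (3.49) p.399);
CMP **116** (1988) 1–22 [Balaban1988RG2Cluster] ((2.7) p.13).
-/

set_option autoImplicit false

noncomputable section

open scoped BigOperators Matrix.Norms.L2Operator InnerProductSpace ComplexConjugate Matrix

namespace Summit.QuantumFields.YangMills.Theorems.Prop7ComplementaryProjectorPointwiseDecay

open Literature.MathematicalPhysics.QuantumFieldTheory.Balaban1983to89
open Finset
open T4Continuum BlockAveraging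
open BlockAveraging (Idx)
open B7Prop1Explicit (U1 disp)
open B5Eq118OneStroke (iterBlockOf iterBlock mem_iterBlock card_iterBlock)
open B10Eq27TorusAxialLog (holT transl)
open B7TransferAnalyticMean (meanCLM)
open B4Sect5Torus (TSite)
open B9Eq311L2Pairing (WL2)
open B11Eq103H1Complex (SiteL2K BondL2K projR)
open Summit.QuantumFields.YangMills.Theorems.Prop8Chart (emlIterU)
open Literature.MathematicalPhysics.QuantumFieldTheory.Balaban1983to89.T3ContinuumYM3Torus
open T3SectALandauChart (eta eta_pos bgUnits)
open T3PrintedRegularMinimiser (RegPr)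
open T3PrintedRegularOrbits (sites_eq)
open T3LevelShift (siteShift)
open Summit.QuantumFields.YangMills.Theorems.Prop7SectET3Transport (periodsT3 siteEquiv)
open Summit.QuantumFields.YangMills.Theorems.Prop7SectET3HilbertLetters (W₂ frobEquiv toL2 toL2S DL2 DstarL2 covLapSite toL2S_apply toL2S_symm_apply inner_frobEquiv_symm)
open Summit.QuantumFields.YangMills.Theorems.Prop7SpanProjectorGramForm (triple_sum_exp_le)
open Summit.QuantumFields.YangMills.Theorems.Prop7SiteEntryCoordinates (orthonormal_spike top_le_span_spike)
open Summit.QuantumFields.YangMills.Theorems.Prop7BlockDistanceWeights (sum_exp_neg_mul_tdist_coarse_le tdist_coarse_comm tdist_coarse_triangle)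
open Summit.QuantumFields.YangMills.Theorems.Prop7ComplementaryProjectorColumns (isUnit_gram_massive_columns norm_inner_sub_projR_le)
open Summit.QuantumFields.YangMills.Theorems.Prop7CoarseGramInverseDecay (spike_eq_lift norm_gram_inv_spike_le_exp_neg_tdist)
open Summit.QuantumFields.YangMills.Theorems.Prop7TopMeanAdjointBlockLocal (inner_toL2S_single_left)
open Summit.QuantumFields.YangMills.Theorems.Prop7ComplementaryProjectorBlockDecay (sum_exp_neg_mul_dc_spike_le)

variable (F : T3Family) {n K : ℕ} (h : n ≤ K) {c₀ c₁ : ℝ} [Fact (0 < c₀)] [Fact (0 < c₁)]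
  {ε₀ : ℝ} (hε₀ : 0 < ε₀) (hε7 : 10 ^ 7 * (F.L : ℝ) ^ 3 * ε₀ ≤ 1)
  (U₀ : GaugeField (F.P K) 0 (Matrix.specialUnitaryGroup (Fin 2) ℂ)) (hreg : RegPr F n K ε₀ U₀)
  (Q'' : SiteL2K ℂ 3 (periodsT3 F K) c₀ W₂ →ₗ[ℂ] (Site (F.P K) (K - n) → Matrix (Fin 2) (Fin 2) ℂ))
  (hseq : ∀ lam : Site (F.P K) 0 → Matrix (Fin 2) (Fin 2) ℂ, ∃ ns : (j : ℕ) → Site (F.P K) j → Matrix (Fin 2) (Fin 2) ℂ, ns 0 = lam ∧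
      (∀ (j : ℕ) (y : Site (F.P K) (j + 1)), ns (j + 1) y = ns j (emb y) - meanCLM (Idx (F.P K)) (Matrix (Fin 2) (Fin 2) ℂ) fun i : Idx (F.P K) =>
        ns j (emb y) - ((holT (emlIterU j (bgUnits F K U₀)) (emb y) (stairWord i.2.1 (off i.1)) : (Matrix (Fin 2) (Fin 2) ℂ)ˣ) : Matrix (Fin 2) (Fin 2) ℂ) *
          ns j (transl (emb y) (disp (stairWord i.2.1 (off i.1)))) * (((holT (emlIterU j (bgUnits F K U₀)) (emb y) (stairWord i.2.1 (off i.1)))⁻¹ : (Matrix (Fin 2) (Fin 2) ℂ)ˣ) : Matrix (Fin 2) (Fin 2) ℂ)) ∧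
      ns (K - n) = Q'' (toL2S F K c₀ lam))
  (ι : (Site (F.P K) (K - n) → Matrix (Fin 2) (Fin 2) ℂ) →ₗ[ℂ] SiteL2K ℂ 3 (periodsT3 F n) c₁ W₂)
  (hι : ∀ c, ι c = toL2S F n c₁ (fun z => c (siteShift (sites_eq F n K h) z)))
  (T : SiteL2K ℂ 3 (periodsT3 F n) c₁ W₂ →ₗ[ℂ] SiteL2K ℂ 3 (periodsT3 F K) c₀ W₂)
  (hT : ∀ (l : SiteL2K ℂ 3 (periodsT3 F K) c₀ W₂) (f : SiteL2K ℂ 3 (periodsT3 F n) c₁ W₂), ⟪ι (Q'' l), f⟫_ℂ = ⟪l, T f⟫_ℂ)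
  {a : ℝ} (ha : 0 < a)
  (G : SiteL2K ℂ 3 (periodsT3 F K) c₀ W₂ →ₗ[ℂ] SiteL2K ℂ 3 (periodsT3 F K) c₀ W₂)
  (hAG : ∀ f, covLapSite F n K c₀ U₀ (G f) + (a : ℂ) • T (ι (Q'' (G f))) = f)
  (hGA : ∀ u, G (covLapSite F n K c₀ U₀ u + (a : ℂ) • T (ι (Q'' u))) = u)

/-! ## §1 The spike-vs-spike column row from the pointwise column letter -/

/-- The spike entry has operator norm `≤ (√c₁)⁻¹`: `‖(√c₁)⁻¹·E_{jk}‖ ≤ (√c₁)⁻¹` (`Σ|E_{jk}|² = 1` dominates the `L²`-operator norm, lit ✓`MatrixNorms.opNorm_sq_le_sum_norm_sq`).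
[cite: Balaban1985Averaging, (20) p.21] -/
theorem norm_spikeEntry_le (j k : Fin 2) :
    ‖((((Real.sqrt c₁ : ℝ) : ℂ))⁻¹ • Matrix.single j k (1 : ℂ) : Matrix (Fin 2) (Fin 2) ℂ)‖ ≤ (Real.sqrt c₁)⁻¹ := by
  have hc₁ : 0 < c₁ := Fact.out
  have hE : ‖(Matrix.single j k (1 : ℂ) : Matrix (Fin 2) (Fin 2) ℂ)‖ ≤ 1 := by
    have h1 := MatrixNorms.opNorm_sq_le_sum_norm_sq (Matrix.single j k (1 : ℂ) : Matrix (Fin 2) (Fin 2) ℂ)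
    have hs : ∑ a' : Fin 2, ∑ b' : Fin 2, ‖(Matrix.single j k (1 : ℂ) : Matrix (Fin 2) (Fin 2) ℂ) a' b'‖ ^ 2 = 1 := by
      simp only [Matrix.single_apply]
      rw [Finset.sum_eq_single j, Finset.sum_eq_single k]
      · simp
      · intro b' _ hb'; simp [Ne.symm hb']
      · simp
      · intro a' _ ha'; rw [Finset.sum_eq_zero]; intro b' _; simp [Ne.symm ha']
      · simp
    rw [hs] at h1
    have h0 : 0 ≤ ‖(Matrix.single j k (1 : ℂ) : Matrix (Fin 2) (Fin 2) ℂ)‖ := norm_nonneg _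
    nlinarith
  rw [norm_smul, norm_inv, Complex.norm_real, Real.norm_of_nonneg (Real.sqrt_nonneg _)]
  exact mul_le_of_le_one_right (inv_nonneg.mpr (Real.sqrt_nonneg _)) hE

include hι in
/-- ★ **A SPIKE COLUMN AGAINST A FINE SPIKE, FROM THE POINTWISE COLUMN LETTER**: if every LOD column obeys the POINTWISE row
`‖ψ_{y,Y}(x)‖_{W₂} ≤ C_pt·e^{−κ·tdist(B(x), y)}·‖Y‖` (`ψ_{y,Y} = G(T(ι(δ_y ⊗ Y)))`, the chair's V4 shape), then for the coarse spike basis vector `b_c i = ι(δ_{σ i.1} ⊗ (√c₁)⁻¹E)`: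
`‖⟪G(T(b_c i)), toL2S(δ_x ⊗ X)⟫‖ ≤ c₀·(√c₁)⁻¹·C_pt·‖X‖_F·e^{−κ·tdist(B(x), σ i.1)}` — the pairing with `δ_x ⊗ X` is `c₀·tr(Xᴴψ(x)) = c₀⟪X, ψ(x)⟫_{W₂}` (✓`inner_toL2S_single_left`,
✓`inner_frobEquiv_symm`), Cauchy–Schwarz in `W₂`. [cite: Balaban1985BackgroundPropagators, (3.11) p.392, (3.16) p.393, Thm 3.1 (3.42) p.397] -/
theorem norm_inner_spike_column_single_le {Cpt κ : ℝ} (hCpt : 0 ≤ Cpt)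
    (hcol : ∀ (y : Site (F.P K) (K - n)) (Y : Matrix (Fin 2) (Fin 2) ℂ) (x : Site (F.P K) 0),
      ‖WL2.equiv ℂ _ W₂ (G (T (ι (Pi.single y Y)))) (siteEquiv F K x)‖ ≤ Cpt * Real.exp (-(κ * (Site.tdist (P := F.P K) (iterBlockOf (K - n) x) y : ℝ))) * ‖Y‖)
    (i : Site (F.P n) 0 × (Fin 2 × Fin 2)) (x : Site (F.P K) 0) (X : Matrix (Fin 2) (Fin 2) ℂ) :
    ‖⟪G (T ((OrthonormalBasis.mk (orthonormal_spike F) (top_le_span_spike F) : OrthonormalBasis (Site (F.P n) 0 × (Fin 2 × Fin 2)) ℂ (SiteL2K ℂ 3 (periodsT3 F n) c₁ W₂)) i)), toL2S F K c₀ (Pi.single x X)⟫_ℂ‖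
      ≤ c₀ * (Real.sqrt c₁)⁻¹ * Cpt * ‖(frobEquiv.symm X : W₂)‖ * Real.exp (-(κ * (Site.tdist (P := F.P K) (iterBlockOf (K - n) x) (siteShift (sites_eq F n K h) i.1) : ℝ))) := by
  have hc₀ : 0 < c₀ := Fact.out
  rw [spike_eq_lift F h ι hι i]
  set Y : Matrix (Fin 2) (Fin 2) ℂ := (((Real.sqrt c₁ : ℝ) : ℂ))⁻¹ • Matrix.single i.2.1 i.2.2 (1 : ℂ) with hY
  set ψ : SiteL2K ℂ 3 (periodsT3 F K) c₀ W₂ := G (T (ι (Pi.single (siteShift (sites_eq F n K h) i.1) Y))) with hψ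
  set v : W₂ := WL2.equiv ℂ _ W₂ ψ (siteEquiv F K x) with hv
  -- the pairing with the fine spike reads the value of `ψ` at `x`
  have hpair : ⟪toL2S F K c₀ (Pi.single x X), ψ⟫_ℂ = (c₀ : ℂ) * ⟪(frobEquiv.symm X : W₂), v⟫_ℂ := by
    have h1 : ψ = toL2S F K c₀ ((toL2S F K c₀).symm ψ) := ((toL2S F K c₀).apply_symm_apply ψ).symm
    rw [h1, inner_toL2S_single_left, toL2S_symm_apply, ← inner_frobEquiv_symm, LinearEquiv.symm_apply_apply, hv]
  have hYn : ‖Y‖ ≤ (Real.sqrt c₁)⁻¹ := norm_spikeEntry_le (c₁ := c₁) i.2.1 i.2.2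
  have hvn : ‖v‖ ≤ Cpt * Real.exp (-(κ * (Site.tdist (P := F.P K) (iterBlockOf (K - n) x) (siteShift (sites_eq F n K h) i.1) : ℝ))) * (Real.sqrt c₁)⁻¹ :=
    (hcol _ Y x).trans (mul_le_mul_of_nonneg_left hYn (mul_nonneg hCpt (Real.exp_pos _).le))
  rw [← inner_conj_symm, RCLike.norm_conj, hpair, norm_mul, Complex.norm_real, Real.norm_of_nonneg hc₀.le]
  calc c₀ * ‖⟪(frobEquiv.symm X : W₂), v⟫_ℂ‖ ≤ c₀ * (‖(frobEquiv.symm X : W₂)‖ * ‖v‖) := mul_le_mul_of_nonneg_left (norm_inner_le_norm _ _) hc₀.le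
    _ ≤ c₀ * (‖(frobEquiv.symm X : W₂)‖ * (Cpt * Real.exp (-(κ * (Site.tdist (P := F.P K) (iterBlockOf (K - n) x) (siteShift (sites_eq F n K h) i.1) : ℝ))) * (Real.sqrt c₁)⁻¹)) :=
        mul_le_mul_of_nonneg_left (mul_le_mul_of_nonneg_left hvn (norm_nonneg _)) hc₀.le
    _ = _ := by ring

/-! ## §2 The pointwise β-row: spike against spike -/

include hε₀ hε7 hreg hseq hι hT ha hAG hGA in
set_option maxHeartbeats 400000 in
-- hb: the statement carries B2c's closed-form Gram constant twice (README №24 class, as ✓`norm_inner_sub_projR_blocks_le`).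
/-- ★★★ **THE KERNEL OF PRINT'S COMPLEMENTARY GAUGE PROJECTOR BETWEEN TWO FINE SPIKES** (the β-row of ✓`norm_inner_sub_projR_blocks_le` with POINTWISE column letters).  For fine sites
`x, x′`, matrices `X, X′`, a Gram slope `μ′ ≥ 0` carrying B2c's window∕gap rows (`hδ`, `hwin`, `hgap`), `‖ι(Q″λ)‖ ≤ C_T‖λ‖`, `‖G‖ ≤ C_G`, the coarse coercivity `m_B‖f‖ ≤ ‖G(Tf)‖`, and the
POINTWISE COLUMN LETTER `hcol` at a rate `κ > μ′`:
`‖⟪toL2S(δ_x ⊗ X), toL2S(δ_{x′} ⊗ X′) − projR Δ_{U₀} Q″ (toL2S(δ_{x′} ⊗ X′))⟫‖ ≤ (c₀(√c₁)⁻¹C_pt‖X‖_F)·(c₀(√c₁)⁻¹C_pt‖X′‖_F)·C_N(μ′)·(4(2(1 + 1∕(κ−μ′)))³)²·e^{−μ′·tdist(B x, B x′)}`,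
`C_N(μ′) = (m_B²∕2 − 3ε(μ′)²)⁻¹e^{9μ′}` — B1 ✓`norm_inner_sub_projR_le` in the coarse spike basis, §1 twice, B2c ✓`norm_gram_inv_spike_le_exp_neg_tdist`, ✓`triple_sum_exp_le`.
[cite: Balaban1985BackgroundPropagators, Thm 3.1 (3.42) p.397, (3.49) p.399; Balaban1988RG2Cluster, (2.7) p.13] -/
theorem norm_inner_single_sub_projR_single_le {μ' κ : ℝ} (hμ' : 0 ≤ μ') (hμ'κ : μ' < κ)
    {δ₁ : ℝ} (hδ₁ : 0 ≤ δ₁)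
    (hδ : 3 * ((eta F n K)⁻¹) ^ 2 * (Real.exp (μ' * eta F n K) - 1) ^ 2 + a * ((25 / 8) * (c₁ * ((((F.P K).L : ℝ) ^ (F.P K).d) ^ (K - n))⁻¹ / c₀)) * (Real.exp (3 * μ') - 1) ^ 2 ≤ δ₁ ^ 2)
    (hwin : Real.sqrt (max 2 (16 * c₀ * ((F.L : ℝ) ^ (K - n)) ^ 3 / (a * c₁))) * δ₁ ≤ 1 / 10)
    {CT : ℝ} (hCT : 0 ≤ CT) (hCTb : ∀ l : SiteL2K ℂ 3 (periodsT3 F K) c₀ W₂, ‖ι (Q'' l)‖ ≤ CT * ‖l‖)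
    {CG : ℝ} (hCG : 0 ≤ CG) (hGn : ∀ f, ‖G f‖ ≤ CG * ‖f‖)
    {mB : ℝ} (hmB : 0 < mB) (hcoer : ∀ f : SiteL2K ℂ 3 (periodsT3 F n) c₁ W₂, mB * ‖f‖ ≤ ‖G (T f)‖)
    (hgap : 3 * ((Real.sqrt (max 2 (16 * c₀ * ((F.L : ℝ) ^ (K - n)) ^ 3 / (a * c₁))) * (2 + Real.sqrt (max 2 (16 * c₀ * ((F.L : ℝ) ^ (K - n)) ^ 3 / (a * c₁)))))
          * (Real.sqrt 3 * (eta F n K)⁻¹ * (Real.exp (μ' * eta F n K) - 1) + (Real.sqrt 3 * (eta F n K)⁻¹ * (Real.exp (μ' * eta F n K) - 1)) ^ 2 + Real.sqrt a * CT * (Real.exp (3 * μ') - 1) + a * CT ^ 2 * (Real.exp (3 * μ') - 1) ^ 2)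
          * (8 * Real.sqrt (max 2 (16 * c₀ * ((F.L : ℝ) ^ (K - n)) ^ 3 / (a * c₁))) + 8 * Real.sqrt (max 2 (16 * c₀ * ((F.L : ℝ) ^ (K - n)) ^ 3 / (a * c₁))) ^ 2)
          * (CT * (1 + (Real.exp (3 * μ') - 1))) + CG * (CT * (Real.exp (3 * μ') - 1))) ^ 2 < mB ^ 2 / 2)
    {Cpt : ℝ} (hCpt : 0 ≤ Cpt)
    (hcol : ∀ (y : Site (F.P K) (K - n)) (Y : Matrix (Fin 2) (Fin 2) ℂ) (x : Site (F.P K) 0),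
      ‖WL2.equiv ℂ _ W₂ (G (T (ι (Pi.single y Y)))) (siteEquiv F K x)‖ ≤ Cpt * Real.exp (-(κ * (Site.tdist (P := F.P K) (iterBlockOf (K - n) x) y : ℝ))) * ‖Y‖)
    (x x' : Site (F.P K) 0) (X X' : Matrix (Fin 2) (Fin 2) ℂ) :
    ‖⟪toL2S F K c₀ (Pi.single x X), toL2S F K c₀ (Pi.single x' X') - projR (covLapSite F n K c₀ U₀) Q'' (toL2S F K c₀ (Pi.single x' X'))⟫_ℂ‖
      ≤ (c₀ * (Real.sqrt c₁)⁻¹ * Cpt * ‖(frobEquiv.symm X : W₂)‖)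
        * (c₀ * (Real.sqrt c₁)⁻¹ * Cpt * ‖(frobEquiv.symm X' : W₂)‖)
        * ((mB ^ 2 / 2 - 3 * ((Real.sqrt (max 2 (16 * c₀ * ((F.L : ℝ) ^ (K - n)) ^ 3 / (a * c₁))) * (2 + Real.sqrt (max 2 (16 * c₀ * ((F.L : ℝ) ^ (K - n)) ^ 3 / (a * c₁)))))
          * (Real.sqrt 3 * (eta F n K)⁻¹ * (Real.exp (μ' * eta F n K) - 1) + (Real.sqrt 3 * (eta F n K)⁻¹ * (Real.exp (μ' * eta F n K) - 1)) ^ 2 + Real.sqrt a * CT * (Real.exp (3 * μ') - 1) + a * CT ^ 2 * (Real.exp (3 * μ') - 1) ^ 2)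
          * (8 * Real.sqrt (max 2 (16 * c₀ * ((F.L : ℝ) ^ (K - n)) ^ 3 / (a * c₁))) + 8 * Real.sqrt (max 2 (16 * c₀ * ((F.L : ℝ) ^ (K - n)) ^ 3 / (a * c₁))) ^ 2)
          * (CT * (1 + (Real.exp (3 * μ') - 1))) + CG * (CT * (Real.exp (3 * μ') - 1))) ^ 2)⁻¹ * Real.exp (9 * μ'))
        * (4 * (2 * (1 + 1 / (κ - μ'))) ^ 3) ^ 2
        * Real.exp (-(μ' * (Site.tdist (P := F.P K) (iterBlockOf (K - n) x) (iterBlockOf (K - n) x') : ℝ))) := by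
  classical
  have hc₀ : 0 < c₀ := Fact.out
  have hc₁ : 0 < c₁ := Fact.out
  have hunit := isUnit_gram_massive_columns F T G (OrthonormalBasis.mk (orthonormal_spike F) (top_le_span_spike F) : OrthonormalBasis (Site (F.P n) 0 × (Fin 2 × Fin 2)) ℂ (SiteL2K ℂ 3 (periodsT3 F n) c₁ W₂)) hmB hcoer
  -- the two column rows (§1), read at the blocks of `x`, `x′`
  have hA : ∀ i : Site (F.P n) 0 × (Fin 2 × Fin 2), ‖⟪G (T ((OrthonormalBasis.mk (orthonormal_spike F) (top_le_span_spike F) : OrthonormalBasis (Site (F.P n) 0 × (Fin 2 × Fin 2)) ℂ (SiteL2K ℂ 3 (periodsT3 F n) c₁ W₂)) i)), toL2S F K c₀ (Pi.single x X)⟫_ℂ‖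
      ≤ c₀ * (Real.sqrt c₁)⁻¹ * Cpt * ‖(frobEquiv.symm X : W₂)‖ * Real.exp (-(κ * (Site.tdist (P := F.P K) (iterBlockOf (K - n) x) (siteShift (sites_eq F n K h) i.1) : ℝ))) :=
    fun i => norm_inner_spike_column_single_le F h ι hι T G hCpt hcol i x X
  have hB : ∀ i' : Site (F.P n) 0 × (Fin 2 × Fin 2), ‖⟪G (T ((OrthonormalBasis.mk (orthonormal_spike F) (top_le_span_spike F) : OrthonormalBasis (Site (F.P n) 0 × (Fin 2 × Fin 2)) ℂ (SiteL2K ℂ 3 (periodsT3 F n) c₁ W₂)) i')), toL2S F K c₀ (Pi.single x' X')⟫_ℂ‖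
      ≤ c₀ * (Real.sqrt c₁)⁻¹ * Cpt * ‖(frobEquiv.symm X' : W₂)‖ * Real.exp (-(κ * (Site.tdist (P := F.P K) (iterBlockOf (K - n) x') (siteShift (sites_eq F n K h) i'.1) : ℝ))) :=
    fun i' => norm_inner_spike_column_single_le F h ι hι T G hCpt hcol i' x' X'
  have hP := norm_inner_sub_projR_le F h U₀ Q'' ι hι T hT G hAG hGA (OrthonormalBasis.mk (orthonormal_spike F) (top_le_span_spike F) : OrthonormalBasis (Site (F.P n) 0 × (Fin 2 × Fin 2)) ℂ (SiteL2K ℂ 3 (periodsT3 F n) c₁ W₂)) hunit (toL2S F K c₀ (Pi.single x X)) (toL2S F K c₀ (Pi.single x' X')) _ _ hA hB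
  refine hP.trans ?_
  -- the inverse Gram decay at slope `μ′` (B2c)
  have hN : ∀ i i' : Site (F.P n) 0 × (Fin 2 × Fin 2),
      ‖(Matrix.of fun i i' : Site (F.P n) 0 × (Fin 2 × Fin 2) => ⟪G (T ((OrthonormalBasis.mk (orthonormal_spike F) (top_le_span_spike F) : OrthonormalBasis (Site (F.P n) 0 × (Fin 2 × Fin 2)) ℂ (SiteL2K ℂ 3 (periodsT3 F n) c₁ W₂)) i)), G (T ((OrthonormalBasis.mk (orthonormal_spike F) (top_le_span_spike F) : OrthonormalBasis (Site (F.P n) 0 × (Fin 2 × Fin 2)) ℂ (SiteL2K ℂ 3 (periodsT3 F n) c₁ W₂)) i'))⟫_ℂ)⁻¹ i i'‖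
        ≤ ((mB ^ 2 / 2 - 3 * ((Real.sqrt (max 2 (16 * c₀ * ((F.L : ℝ) ^ (K - n)) ^ 3 / (a * c₁))) * (2 + Real.sqrt (max 2 (16 * c₀ * ((F.L : ℝ) ^ (K - n)) ^ 3 / (a * c₁)))))
          * (Real.sqrt 3 * (eta F n K)⁻¹ * (Real.exp (μ' * eta F n K) - 1) + (Real.sqrt 3 * (eta F n K)⁻¹ * (Real.exp (μ' * eta F n K) - 1)) ^ 2 + Real.sqrt a * CT * (Real.exp (3 * μ') - 1) + a * CT ^ 2 * (Real.exp (3 * μ') - 1) ^ 2)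
          * (8 * Real.sqrt (max 2 (16 * c₀ * ((F.L : ℝ) ^ (K - n)) ^ 3 / (a * c₁))) + 8 * Real.sqrt (max 2 (16 * c₀ * ((F.L : ℝ) ^ (K - n)) ^ 3 / (a * c₁))) ^ 2)
          * (CT * (1 + (Real.exp (3 * μ') - 1))) + CG * (CT * (Real.exp (3 * μ') - 1))) ^ 2)⁻¹ * Real.exp (9 * μ')) * Real.exp (-(μ' * (fun i j : Site (F.P n) 0 × (Fin 2 × Fin 2) => (Site.tdist (P := F.P K) (siteShift (sites_eq F n K h) i.1) (siteShift (sites_eq F n K h) j.1) : ℝ)) i i')) :=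
    fun i i' => norm_gram_inv_spike_le_exp_neg_tdist F h hε₀ hε7 U₀ hreg Q'' hseq ι hι T hT ha G hAG hμ' hδ₁ hδ hwin hCT hCTb hCG hGn hmB hcoer hgap i i'
  -- the pseudo-metric and the volume
  have hds : ∀ i j : Site (F.P n) 0 × (Fin 2 × Fin 2), (fun i j : Site (F.P n) 0 × (Fin 2 × Fin 2) => (Site.tdist (P := F.P K) (siteShift (sites_eq F n K h) i.1) (siteShift (sites_eq F n K h) j.1) : ℝ)) i j = (fun i j : Site (F.P n) 0 × (Fin 2 × Fin 2) => (Site.tdist (P := F.P K) (siteShift (sites_eq F n K h) i.1) (siteShift (sites_eq F n K h) j.1) : ℝ)) j i := fun i j => tdist_coarse_comm F _ _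
  have hdt : ∀ i j k : Site (F.P n) 0 × (Fin 2 × Fin 2), (fun i j : Site (F.P n) 0 × (Fin 2 × Fin 2) => (Site.tdist (P := F.P K) (siteShift (sites_eq F n K h) i.1) (siteShift (sites_eq F n K h) j.1) : ℝ)) i k ≤ (fun i j : Site (F.P n) 0 × (Fin 2 × Fin 2) => (Site.tdist (P := F.P K) (siteShift (sites_eq F n K h) i.1) (siteShift (sites_eq F n K h) j.1) : ℝ)) i j + (fun i j : Site (F.P n) 0 × (Fin 2 × Fin 2) => (Site.tdist (P := F.P K) (siteShift (sites_eq F n K h) i.1) (siteShift (sites_eq F n K h) j.1) : ℝ)) j k := fun i j k => tdist_coarse_triangle F _ _ _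
  have hν : 0 < κ - μ' := sub_pos.2 hμ'κ
  have hvol' : ∀ i₀ : Site (F.P n) 0 × (Fin 2 × Fin 2),
      ∑ i : Site (F.P n) 0 × (Fin 2 × Fin 2), Real.exp (-((κ - μ') * (fun i j : Site (F.P n) 0 × (Fin 2 × Fin 2) => (Site.tdist (P := F.P K) (siteShift (sites_eq F n K h) i.1) (siteShift (sites_eq F n K h) j.1) : ℝ)) i i₀)) ≤ 4 * (2 * (1 + 1 / (κ - μ'))) ^ 3 :=
    fun i₀ => sum_exp_neg_mul_dc_spike_le F h hν i₀
  have hC₁ : 0 ≤ c₀ * (Real.sqrt c₁)⁻¹ * Cpt * ‖(frobEquiv.symm X : W₂)‖ := by positivity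
  have hC₂ : 0 ≤ c₀ * (Real.sqrt c₁)⁻¹ * Cpt * ‖(frobEquiv.symm X' : W₂)‖ := by positivity
  have hCN : 0 ≤ ((mB ^ 2 / 2 - 3 * ((Real.sqrt (max 2 (16 * c₀ * ((F.L : ℝ) ^ (K - n)) ^ 3 / (a * c₁))) * (2 + Real.sqrt (max 2 (16 * c₀ * ((F.L : ℝ) ^ (K - n)) ^ 3 / (a * c₁)))))
          * (Real.sqrt 3 * (eta F n K)⁻¹ * (Real.exp (μ' * eta F n K) - 1) + (Real.sqrt 3 * (eta F n K)⁻¹ * (Real.exp (μ' * eta F n K) - 1)) ^ 2 + Real.sqrt a * CT * (Real.exp (3 * μ') - 1) + a * CT ^ 2 * (Real.exp (3 * μ') - 1) ^ 2)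
          * (8 * Real.sqrt (max 2 (16 * c₀ * ((F.L : ℝ) ^ (K - n)) ^ 3 / (a * c₁))) + 8 * Real.sqrt (max 2 (16 * c₀ * ((F.L : ℝ) ^ (K - n)) ^ 3 / (a * c₁))) ^ 2)
          * (CT * (1 + (Real.exp (3 * μ') - 1))) + CG * (CT * (Real.exp (3 * μ') - 1))) ^ 2)⁻¹ * Real.exp (9 * μ')) :=
    mul_nonneg (le_of_lt (inv_pos.2 (sub_pos.2 hgap))) (Real.exp_pos _).le
  have h3 := triple_sum_exp_le (fun i j : Site (F.P n) 0 × (Fin 2 × Fin 2) => (Site.tdist (P := F.P K) (siteShift (sites_eq F n K h) i.1) (siteShift (sites_eq F n K h) j.1) : ℝ)) hds hdt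
    (fun i : Site (F.P n) 0 × (Fin 2 × Fin 2) => c₀ * (Real.sqrt c₁)⁻¹ * Cpt * ‖(frobEquiv.symm X : W₂)‖
      * Real.exp (-(κ * (Site.tdist (P := F.P K) (iterBlockOf (K - n) x) (siteShift (sites_eq F n K h) i.1) : ℝ))))
    (fun i' : Site (F.P n) 0 × (Fin 2 × Fin 2) => c₀ * (Real.sqrt c₁)⁻¹ * Cpt * ‖(frobEquiv.symm X' : W₂)‖
      * Real.exp (-(κ * (Site.tdist (P := F.P K) (iterBlockOf (K - n) x') (siteShift (sites_eq F n K h) i'.1) : ℝ))))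
    (fun i i' => ‖(Matrix.of fun i i' : Site (F.P n) 0 × (Fin 2 × Fin 2) => ⟪G (T ((OrthonormalBasis.mk (orthonormal_spike F) (top_le_span_spike F) : OrthonormalBasis (Site (F.P n) 0 × (Fin 2 × Fin 2)) ℂ (SiteL2K ℂ 3 (periodsT3 F n) c₁ W₂)) i)), G (T ((OrthonormalBasis.mk (orthonormal_spike F) (top_le_span_spike F) : OrthonormalBasis (Site (F.P n) 0 × (Fin 2 × Fin 2)) ℂ (SiteL2K ℂ 3 (periodsT3 F n) c₁ W₂)) i'))⟫_ℂ)⁻¹ i i'‖)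
    hC₁ hC₂ hCN hμ' (fun i' => (hB i').trans' (norm_nonneg _)) (fun _ _ => norm_nonneg _)
    ((siteShift (sites_eq F n K h)).symm (iterBlockOf (K - n) x), ((0 : Fin 2), (0 : Fin 2))) ((siteShift (sites_eq F n K h)).symm (iterBlockOf (K - n) x'), ((0 : Fin 2), (0 : Fin 2)))
    (fun i => by simp only [Equiv.apply_symm_apply]; exact le_rfl) (fun i' => by simp only [Equiv.apply_symm_apply]; exact le_rfl) hN hvol'
  simp only [Equiv.apply_symm_apply] at h3
  exact h3

/-! ## §3 The pointwise value kernel of `P` -/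

include hε₀ hε7 hreg hseq hι hT ha hAG hGA in
set_option maxHeartbeats 400000 in
-- hb: as §2 (the closed-form Gram constant in the statement).
/-- ★★ **THE POINTWISE VALUE KERNEL OF `P = 1 − R_{Q″}(U₀)`** (print's (3.49), VALUE half, with its `η³`): under the letters of §2,
`‖((1 − projR Δ_{U₀} Q″)(toL2S(δ_{x′} ⊗ X′)))(x)‖_{W₂} ≤ (c₀∕c₁)·C_pt²·C_N(μ′)·(4(2(1 + 1∕(κ−μ′)))³)²·e^{−μ′·tdist(B x, B x′)}·‖X′‖_F` — §2 tested against the spike `δ_x ⊗ (Pg)(x)`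
(`⟪toL2S(δ_x ⊗ X), g⟫ = c₀⟪X, g(x)⟫_{W₂}`), divided by `c₀‖(Pg)(x)‖`.  At the pin `c₁ = c₀ℓ³`: `c₀∕c₁ = η³`. [cite: Balaban1985BackgroundPropagators, Thm 3.1 (3.42) p.397, (3.49) p.399] -/
theorem norm_equiv_sub_projR_single_le {μ' κ : ℝ} (hμ' : 0 ≤ μ') (hμ'κ : μ' < κ)
    {δ₁ : ℝ} (hδ₁ : 0 ≤ δ₁)
    (hδ : 3 * ((eta F n K)⁻¹) ^ 2 * (Real.exp (μ' * eta F n K) - 1) ^ 2 + a * ((25 / 8) * (c₁ * ((((F.P K).L : ℝ) ^ (F.P K).d) ^ (K - n))⁻¹ / c₀)) * (Real.exp (3 * μ') - 1) ^ 2 ≤ δ₁ ^ 2)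
    (hwin : Real.sqrt (max 2 (16 * c₀ * ((F.L : ℝ) ^ (K - n)) ^ 3 / (a * c₁))) * δ₁ ≤ 1 / 10)
    {CT : ℝ} (hCT : 0 ≤ CT) (hCTb : ∀ l : SiteL2K ℂ 3 (periodsT3 F K) c₀ W₂, ‖ι (Q'' l)‖ ≤ CT * ‖l‖)
    {CG : ℝ} (hCG : 0 ≤ CG) (hGn : ∀ f, ‖G f‖ ≤ CG * ‖f‖)
    {mB : ℝ} (hmB : 0 < mB) (hcoer : ∀ f : SiteL2K ℂ 3 (periodsT3 F n) c₁ W₂, mB * ‖f‖ ≤ ‖G (T f)‖)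
    (hgap : 3 * ((Real.sqrt (max 2 (16 * c₀ * ((F.L : ℝ) ^ (K - n)) ^ 3 / (a * c₁))) * (2 + Real.sqrt (max 2 (16 * c₀ * ((F.L : ℝ) ^ (K - n)) ^ 3 / (a * c₁)))))
          * (Real.sqrt 3 * (eta F n K)⁻¹ * (Real.exp (μ' * eta F n K) - 1) + (Real.sqrt 3 * (eta F n K)⁻¹ * (Real.exp (μ' * eta F n K) - 1)) ^ 2 + Real.sqrt a * CT * (Real.exp (3 * μ') - 1) + a * CT ^ 2 * (Real.exp (3 * μ') - 1) ^ 2)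
          * (8 * Real.sqrt (max 2 (16 * c₀ * ((F.L : ℝ) ^ (K - n)) ^ 3 / (a * c₁))) + 8 * Real.sqrt (max 2 (16 * c₀ * ((F.L : ℝ) ^ (K - n)) ^ 3 / (a * c₁))) ^ 2)
          * (CT * (1 + (Real.exp (3 * μ') - 1))) + CG * (CT * (Real.exp (3 * μ') - 1))) ^ 2 < mB ^ 2 / 2)
    {Cpt : ℝ} (hCpt : 0 ≤ Cpt)
    (hcol : ∀ (y : Site (F.P K) (K - n)) (Y : Matrix (Fin 2) (Fin 2) ℂ) (x : Site (F.P K) 0),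
      ‖WL2.equiv ℂ _ W₂ (G (T (ι (Pi.single y Y)))) (siteEquiv F K x)‖ ≤ Cpt * Real.exp (-(κ * (Site.tdist (P := F.P K) (iterBlockOf (K - n) x) y : ℝ))) * ‖Y‖)
    (x x' : Site (F.P K) 0) (X' : Matrix (Fin 2) (Fin 2) ℂ) :
    ‖WL2.equiv ℂ _ W₂ (toL2S F K c₀ (Pi.single x' X') - projR (covLapSite F n K c₀ U₀) Q'' (toL2S F K c₀ (Pi.single x' X'))) (siteEquiv F K x)‖
      ≤ (c₀ / c₁) * Cpt ^ 2 * ((mB ^ 2 / 2 - 3 * ((Real.sqrt (max 2 (16 * c₀ * ((F.L : ℝ) ^ (K - n)) ^ 3 / (a * c₁))) * (2 + Real.sqrt (max 2 (16 * c₀ * ((F.L : ℝ) ^ (K - n)) ^ 3 / (a * c₁)))))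
          * (Real.sqrt 3 * (eta F n K)⁻¹ * (Real.exp (μ' * eta F n K) - 1) + (Real.sqrt 3 * (eta F n K)⁻¹ * (Real.exp (μ' * eta F n K) - 1)) ^ 2 + Real.sqrt a * CT * (Real.exp (3 * μ') - 1) + a * CT ^ 2 * (Real.exp (3 * μ') - 1) ^ 2)
          * (8 * Real.sqrt (max 2 (16 * c₀ * ((F.L : ℝ) ^ (K - n)) ^ 3 / (a * c₁))) + 8 * Real.sqrt (max 2 (16 * c₀ * ((F.L : ℝ) ^ (K - n)) ^ 3 / (a * c₁))) ^ 2)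
          * (CT * (1 + (Real.exp (3 * μ') - 1))) + CG * (CT * (Real.exp (3 * μ') - 1))) ^ 2)⁻¹ * Real.exp (9 * μ'))
        * (4 * (2 * (1 + 1 / (κ - μ'))) ^ 3) ^ 2
        * Real.exp (-(μ' * (Site.tdist (P := F.P K) (iterBlockOf (K - n) x) (iterBlockOf (K - n) x') : ℝ))) * ‖(frobEquiv.symm X' : W₂)‖ := by
  have hc₀ : 0 < c₀ := Fact.out
  have hc₁ : 0 < c₁ := Fact.out
  set g : SiteL2K ℂ 3 (periodsT3 F K) c₀ W₂ := toL2S F K c₀ (Pi.single x' X') - projR (covLapSite F n K c₀ U₀) Q'' (toL2S F K c₀ (Pi.single x' X')) with hg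
  set v : W₂ := WL2.equiv ℂ _ W₂ g (siteEquiv F K x) with hv
  set X : Matrix (Fin 2) (Fin 2) ℂ := frobEquiv v with hX
  -- the spike test: `⟪toL2S(δ_x ⊗ X), g⟫ = c₀‖v‖²`
  have hXv : (frobEquiv.symm X : W₂) = v := by rw [hX, LinearEquiv.symm_apply_apply]
  have hpair : ⟪toL2S F K c₀ (Pi.single x X), g⟫_ℂ = (c₀ : ℂ) * ⟪v, v⟫_ℂ := by
    have h1 : g = toL2S F K c₀ ((toL2S F K c₀).symm g) := ((toL2S F K c₀).apply_symm_apply g).symm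
    rw [h1, inner_toL2S_single_left, toL2S_symm_apply, ← inner_frobEquiv_symm, LinearEquiv.symm_apply_apply]
  have hnorm : ‖⟪toL2S F K c₀ (Pi.single x X), g⟫_ℂ‖ = c₀ * ‖v‖ ^ 2 := by
    rw [hpair, norm_mul, Complex.norm_real, Real.norm_of_nonneg hc₀.le, inner_self_eq_norm_sq_to_K, norm_pow, RCLike.norm_ofReal, abs_norm]
  -- §2 against this spike
  have h2 := norm_inner_single_sub_projR_single_le F h hε₀ hε7 U₀ hreg Q'' hseq ι hι T hT ha G hAG hGA hμ' hμ'κ hδ₁ hδ hwin hCT hCTb hCG hGn hmB hcoer hgap hCpt hcol x x' X X'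
  rw [← hg, hnorm, hXv] at h2
  -- abbreviate the constant
  have hCN : 0 ≤ ((mB ^ 2 / 2 - 3 * ((Real.sqrt (max 2 (16 * c₀ * ((F.L : ℝ) ^ (K - n)) ^ 3 / (a * c₁))) * (2 + Real.sqrt (max 2 (16 * c₀ * ((F.L : ℝ) ^ (K - n)) ^ 3 / (a * c₁)))))
          * (Real.sqrt 3 * (eta F n K)⁻¹ * (Real.exp (μ' * eta F n K) - 1) + (Real.sqrt 3 * (eta F n K)⁻¹ * (Real.exp (μ' * eta F n K) - 1)) ^ 2 + Real.sqrt a * CT * (Real.exp (3 * μ') - 1) + a * CT ^ 2 * (Real.exp (3 * μ') - 1) ^ 2)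
          * (8 * Real.sqrt (max 2 (16 * c₀ * ((F.L : ℝ) ^ (K - n)) ^ 3 / (a * c₁))) + 8 * Real.sqrt (max 2 (16 * c₀ * ((F.L : ℝ) ^ (K - n)) ^ 3 / (a * c₁))) ^ 2)
          * (CT * (1 + (Real.exp (3 * μ') - 1))) + CG * (CT * (Real.exp (3 * μ') - 1))) ^ 2)⁻¹ * Real.exp (9 * μ')) :=
    mul_nonneg (le_of_lt (inv_pos.2 (sub_pos.2 hgap))) (Real.exp_pos _).le
  have hK0 : 0 ≤ (c₀ / c₁) * Cpt ^ 2 * ((mB ^ 2 / 2 - 3 * ((Real.sqrt (max 2 (16 * c₀ * ((F.L : ℝ) ^ (K - n)) ^ 3 / (a * c₁))) * (2 + Real.sqrt (max 2 (16 * c₀ * ((F.L : ℝ) ^ (K - n)) ^ 3 / (a * c₁)))))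
          * (Real.sqrt 3 * (eta F n K)⁻¹ * (Real.exp (μ' * eta F n K) - 1) + (Real.sqrt 3 * (eta F n K)⁻¹ * (Real.exp (μ' * eta F n K) - 1)) ^ 2 + Real.sqrt a * CT * (Real.exp (3 * μ') - 1) + a * CT ^ 2 * (Real.exp (3 * μ') - 1) ^ 2)
          * (8 * Real.sqrt (max 2 (16 * c₀ * ((F.L : ℝ) ^ (K - n)) ^ 3 / (a * c₁))) + 8 * Real.sqrt (max 2 (16 * c₀ * ((F.L : ℝ) ^ (K - n)) ^ 3 / (a * c₁))) ^ 2)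
          * (CT * (1 + (Real.exp (3 * μ') - 1))) + CG * (CT * (Real.exp (3 * μ') - 1))) ^ 2)⁻¹ * Real.exp (9 * μ'))
        * (4 * (2 * (1 + 1 / (κ - μ'))) ^ 3) ^ 2
        * Real.exp (-(μ' * (Site.tdist (P := F.P K) (iterBlockOf (K - n) x) (iterBlockOf (K - n) x') : ℝ))) * ‖(frobEquiv.symm X' : W₂)‖ :=
    mul_nonneg (mul_nonneg (mul_nonneg (mul_nonneg (by positivity) hCN) (by positivity)) (Real.exp_pos _).le) (norm_nonneg _)
  set M : ℝ := ((mB ^ 2 / 2 - 3 * ((Real.sqrt (max 2 (16 * c₀ * ((F.L : ℝ) ^ (K - n)) ^ 3 / (a * c₁))) * (2 + Real.sqrt (max 2 (16 * c₀ * ((F.L : ℝ) ^ (K - n)) ^ 3 / (a * c₁)))))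
          * (Real.sqrt 3 * (eta F n K)⁻¹ * (Real.exp (μ' * eta F n K) - 1) + (Real.sqrt 3 * (eta F n K)⁻¹ * (Real.exp (μ' * eta F n K) - 1)) ^ 2 + Real.sqrt a * CT * (Real.exp (3 * μ') - 1) + a * CT ^ 2 * (Real.exp (3 * μ') - 1) ^ 2)
          * (8 * Real.sqrt (max 2 (16 * c₀ * ((F.L : ℝ) ^ (K - n)) ^ 3 / (a * c₁))) + 8 * Real.sqrt (max 2 (16 * c₀ * ((F.L : ℝ) ^ (K - n)) ^ 3 / (a * c₁))) ^ 2)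
          * (CT * (1 + (Real.exp (3 * μ') - 1))) + CG * (CT * (Real.exp (3 * μ') - 1))) ^ 2)⁻¹ * Real.exp (9 * μ')) * (4 * (2 * (1 + 1 / (κ - μ'))) ^ 3) ^ 2
      * Real.exp (-(μ' * (Site.tdist (P := F.P K) (iterBlockOf (K - n) x) (iterBlockOf (K - n) x') : ℝ))) with hM
  have h2' : c₀ * ‖v‖ ^ 2 ≤ (c₀ * ((c₀ / c₁) * Cpt ^ 2 * M * ‖(frobEquiv.symm X' : W₂)‖)) * ‖v‖ := by
    have e : (c₀ * (Real.sqrt c₁)⁻¹ * Cpt * ‖v‖) * (c₀ * (Real.sqrt c₁)⁻¹ * Cpt * ‖(frobEquiv.symm X' : W₂)‖) * ((mB ^ 2 / 2 - 3 * ((Real.sqrt (max 2 (16 * c₀ * ((F.L : ℝ) ^ (K - n)) ^ 3 / (a * c₁))) * (2 + Real.sqrt (max 2 (16 * c₀ * ((F.L : ℝ) ^ (K - n)) ^ 3 / (a * c₁)))))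
          * (Real.sqrt 3 * (eta F n K)⁻¹ * (Real.exp (μ' * eta F n K) - 1) + (Real.sqrt 3 * (eta F n K)⁻¹ * (Real.exp (μ' * eta F n K) - 1)) ^ 2 + Real.sqrt a * CT * (Real.exp (3 * μ') - 1) + a * CT ^ 2 * (Real.exp (3 * μ') - 1) ^ 2)
          * (8 * Real.sqrt (max 2 (16 * c₀ * ((F.L : ℝ) ^ (K - n)) ^ 3 / (a * c₁))) + 8 * Real.sqrt (max 2 (16 * c₀ * ((F.L : ℝ) ^ (K - n)) ^ 3 / (a * c₁))) ^ 2)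
          * (CT * (1 + (Real.exp (3 * μ') - 1))) + CG * (CT * (Real.exp (3 * μ') - 1))) ^ 2)⁻¹ * Real.exp (9 * μ'))
        * (4 * (2 * (1 + 1 / (κ - μ'))) ^ 3) ^ 2
        * Real.exp (-(μ' * (Site.tdist (P := F.P K) (iterBlockOf (K - n) x) (iterBlockOf (K - n) x') : ℝ)))
        = (c₀ * ((c₀ / c₁) * Cpt ^ 2 * M * ‖(frobEquiv.symm X' : W₂)‖)) * ‖v‖ := by
      have hs : ((Real.sqrt c₁)⁻¹) ^ 2 = c₁⁻¹ := by
        rw [inv_pow, Real.sq_sqrt hc₁.le]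
      rw [hM, div_eq_mul_inv c₀ c₁, ← hs]; ring
    rw [← e]; exact h2
  by_cases hv0 : ‖v‖ = 0
  · rw [hv0]; exact hK0
  · have hvpos : 0 < ‖v‖ := lt_of_le_of_ne (norm_nonneg _) (Ne.symm hv0)
    have h4 : c₀ * ‖v‖ ≤ c₀ * ((c₀ / c₁) * Cpt ^ 2 * M * ‖(frobEquiv.symm X' : W₂)‖) := by
      have := h2'
      rw [sq, ← mul_assoc] at this
      exact le_of_mul_le_mul_right this hvpos
    have h5 : ‖v‖ ≤ (c₀ / c₁) * Cpt ^ 2 * M * ‖(frobEquiv.symm X' : W₂)‖ := le_of_mul_le_mul_left h4 hc₀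
    calc ‖v‖ ≤ (c₀ / c₁) * Cpt ^ 2 * M * ‖(frobEquiv.symm X' : W₂)‖ := h5
      _ = _ := by rw [hM]; ring

end Summit.QuantumFields.YangMills.Theorems.Prop7ComplementaryProjectorPointwiseDecay

end
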